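import Summits.CriticalPhenomena.PercolationContinuityZ3.Theses.PercNonProliferation
import Summits.CriticalPhenomena.PercolationContinuityZ3.Theorems.NonProliferation.Negative.AboveSix
import Literature.Barriers.CriticalPhenomena.SpanningClustersAboveSix
import Literature.Probability.Percolation.RussoFormula
import Literature.Probability.Percolation.HalfSpaceBGN
import HarnessLib

/-!
# Crux `PercNonProliferation.NonProliferation` (stmt-CriticalPhenomena-4444), line `birth-merge-ledger` — stub `stub_ledger`

Helper file for the lead's skeleton of line `birth-merge-ledger`
(`Cruxes/NonProliferation/Lines/birth_merge_ledger.lean`, prover-line-stmt-CriticalPhenomena-4444-0).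
Proves exactly the registered stub signature `stub_ledger`; lands with `--supports stmt-CriticalPhenomena-4444`.

## Content

Calculus glue of the birth/merge LEDGER. With `P_t` bond percolation on `ℤ^d` at parameter
`π(t) = projIcc 0 1 t`, `A_k = repEvent d k n` (so that `E_t[N_n] = Σ_{k < #B(n)} P_t(A_k)` by the
layer-cake formula), `K = B(2n)^{(2)}` the pairs of the box and `F = edgesIn ℤ^d B(2n) = K ∩ E(ℤ^d)`:

* every `A_k`, and the birth / merge events `birth_e`, `merge_e` (Boolean combinations of clauses
  `ω \ {e} ∈ {u ↔ v in B(2n)}`), are determined by `K` (`PlanarDuality.determinedBy_openConnIn`;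
  `StubLedger.determinedBy_repEvent`, `StubLedger.sdiff_mem_openConnIn_congr`), hence measurable and
  with `t ↦ P_t(·)` continuous on `ℝ` (`continuous_bondPercolation_real_of_determinedBy ∘ projIcc`);
* the signed Russo formula (hypothesis) and `HasDerivAt.fun_sum` differentiate
  `f(t) = Σ_k P_t(A_k)` on `(0,1)`; swapping the sums, discarding the non-edges of `K` (empty
  events) and integrating the pointwise type table (hypothesis) edge by edge
  (`StubLedger.sum_real_insert_sub_sdiff`: `Σ_k (P{ω ∪ {e} ∈ A_k} - P{ω \ {e} ∈ A_k}) =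
  ∫ Σ_k (1_{A_k}(ω ∪ {e}) - 1_{A_k}(ω \ {e})) dP = ∫ (1_birth - 1_merge) dP`) gives
  `f' = births - merges` (`StubLedger.sum_sum_eq_sub`);
* the fundamental theorem of calculus on `[a,b] ⊆ [0,1]`
  (`intervalIntegral.integral_eq_sub_of_hasDerivAt_of_le`, `intervalIntegral.integral_sub`)
  is `StubLedger.ledger_of`, stated for abstract families `A`, `B`, `M`; the stub instantiates it.

Sources: Grimmett, *Percolation* (1999), §2.4 (Russo's formula and its integrated use);
Aizenman–Kesten–Newman (1987) / Burton–Keane (1989) style birth–merge bookkeeping is only the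
motivation for the names.
-/

noncomputable section

namespace Summit.CriticalPhenomena.PercolationContinuityZ3.Theorems.NonProliferation

open MeasureTheory Filter Topology
open Literature.Probability.LatticeModels Literature.Probability.Percolation
open Literature.Barriers.CriticalPhenomena
open Summit.CriticalPhenomena.PercolationContinuityZ3.Theorems.NonProliferation.Negative

namespace StubLedger

/-! ### Locality of the events -/

section Locality

variable {V : Type*}

/-- Configurations agreeing on the pairs of `B` have the same open connections inside `B`
(`PlanarDuality.determinedBy_openConnIn`, set-theoretic form). -/
theorem mem_openConnIn_congr (B : Finset V) {ω ω' : Set (Sym2 V)}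
    (h : ω ∩ (↑B.sym2 : Set (Sym2 V)) = ω' ∩ ↑B.sym2) (x y : V) :
    ω ∈ openConnIn (↑B : Set V) x y ↔ ω' ∈ openConnIn (↑B : Set V) x y :=
  (determinedBy_iff _ _).1 (PlanarDuality.determinedBy_openConnIn B x y) ω ω' h

/-- Configurations agreeing on the pairs of `B` still agree there after closing the edge `e`, hence
have the same open connections inside `B` after closing `e`. -/
theorem sdiff_mem_openConnIn_congr (B : Finset V) {ω ω' : Set (Sym2 V)}
    (h : ω ∩ (↑B.sym2 : Set (Sym2 V)) = ω' ∩ ↑B.sym2) (e : Sym2 V) (x y : V) :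
    ω \ {e} ∈ openConnIn (↑B : Set V) x y ↔ ω' \ {e} ∈ openConnIn (↑B : Set V) x y :=
  mem_openConnIn_congr B (by rw [Set.sdiff_inter_right_comm, Set.sdiff_inter_right_comm, h]) x y

end Locality

/-- The representative event `repEvent d M n` is determined by the pairs of `B(2n)` (each clause is
an open connection inside `B(2n)`). -/
theorem determinedBy_repEvent (d M n : ℕ) :
    DeterminedBy (repEvent d M n) (↑(box d (2 * n)).sym2 : Set (Sym2 (Site d))) := by
  refine (determinedBy_iff _ _).2 fun ω ω' h => ?_
  have key := mem_openConnIn_congr (box d (2 * n)) h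
  simp only [repEvent, Set.mem_setOf_eq, key]

/-! ### Measure-theoretic glue: from the pointwise type table to probabilities -/

section Table

variable {ι : Type*}

/-- Opening a fixed edge is a measurable map of configurations. -/
theorem measurable_insert (e : ι) : Measurable fun ω : Set ι => insert e ω :=
  measurable_set_iff.2 fun a => by
    simp only [Set.mem_insert_iff]
    exact measurable_const.or (measurable_set_mem a)

/-- Closing a fixed edge is a measurable map of configurations. -/
theorem measurable_sdiff_singleton (e : ι) : Measurable fun ω : Set ι => ω \ {e} :=
  measurable_set_iff.2 fun a => by
    simp only [Set.mem_sdiff, Set.mem_singleton_iff]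
    exact (measurable_set_mem a).and measurable_const

/-- `P{ω | ω ∪ {e} ∈ A} = ∫ 1_A(ω ∪ {e}) dP`. -/
theorem real_setOf_insert_mem (μ : Measure (Set ι)) [IsFiniteMeasure μ] (e : ι) {A : Set (Set ι)}
    (hA : MeasurableSet A) :
    μ.real {ω | insert e ω ∈ A} = ∫ ω, A.indicator (fun _ => (1 : ℝ)) (insert e ω) ∂μ := by
  have hs : MeasurableSet {ω : Set ι | insert e ω ∈ A} := measurable_insert e hA
  rw [← mul_one (μ.real _), ← smul_eq_mul, ← integral_indicator_const (1 : ℝ) hs]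
  rfl

/-- `P{ω | ω \ {e} ∈ A} = ∫ 1_A(ω \ {e}) dP`. -/
theorem real_setOf_sdiff_mem (μ : Measure (Set ι)) [IsFiniteMeasure μ] (e : ι) {A : Set (Set ι)}
    (hA : MeasurableSet A) :
    μ.real {ω | ω \ {e} ∈ A} = ∫ ω, A.indicator (fun _ => (1 : ℝ)) (ω \ {e}) ∂μ := by
  have hs : MeasurableSet {ω : Set ι | ω \ {e} ∈ A} := measurable_sdiff_singleton e hA
  rw [← mul_one (μ.real _), ← smul_eq_mul, ← integral_indicator_const (1 : ℝ) hs]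
  rfl

/-- **Integrating the type table.** If pointwise
`Σ_{k<N} (1_{A_k}(ω ∪ {e}) - 1_{A_k}(ω \ {e})) = 1_B(ω) - 1_M(ω)`, then
`Σ_{k<N} (P{ω ∪ {e} ∈ A_k} - P{ω \ {e} ∈ A_k}) = P(B) - P(M)`. -/
theorem sum_real_insert_sub_sdiff (μ : Measure (Set ι)) [IsFiniteMeasure μ] (e : ι) {N : ℕ}
    {A : ℕ → Set (Set ι)} {B M : Set (Set ι)} (hA : ∀ k, MeasurableSet (A k))
    (hB : MeasurableSet B) (hM : MeasurableSet M)
    (ht : ∀ ω : Set ι, (∑ k ∈ Finset.range N, ((A k).indicator (fun _ => (1 : ℝ)) (insert e ω) -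
      (A k).indicator (fun _ => (1 : ℝ)) (ω \ {e}))) =
      B.indicator (fun _ => (1 : ℝ)) ω - M.indicator (fun _ => (1 : ℝ)) ω) :
    (∑ k ∈ Finset.range N, (μ.real {ω | insert e ω ∈ A k} - μ.real {ω | ω \ {e} ∈ A k})) =
      μ.real B - μ.real M := by
  have hi1 : ∀ k, Integrable (fun ω : Set ι => (A k).indicator (fun _ => (1 : ℝ)) (insert e ω)) μ :=
    fun k => (integrable_const (1 : ℝ)).indicator (measurable_insert e (hA k))
  have hi2 : ∀ k, Integrable (fun ω : Set ι => (A k).indicator (fun _ => (1 : ℝ)) (ω \ {e})) μ :=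
    fun k => (integrable_const (1 : ℝ)).indicator (measurable_sdiff_singleton e (hA k))
  calc (∑ k ∈ Finset.range N, (μ.real {ω | insert e ω ∈ A k} - μ.real {ω | ω \ {e} ∈ A k}))
      = ∑ k ∈ Finset.range N, ∫ ω, ((A k).indicator (fun _ => (1 : ℝ)) (insert e ω) -
          (A k).indicator (fun _ => (1 : ℝ)) (ω \ {e})) ∂μ := by
        refine Finset.sum_congr rfl fun k _ => ?_
        rw [integral_sub (hi1 k) (hi2 k), real_setOf_insert_mem μ e (hA k),
          real_setOf_sdiff_mem μ e (hA k)]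
    _ = ∫ ω, ∑ k ∈ Finset.range N, ((A k).indicator (fun _ => (1 : ℝ)) (insert e ω) -
          (A k).indicator (fun _ => (1 : ℝ)) (ω \ {e})) ∂μ :=
        (integral_finsetSum _ fun k _ => (hi1 k).sub (hi2 k)).symm
    _ = ∫ ω, (B.indicator (fun _ => (1 : ℝ)) ω - M.indicator (fun _ => (1 : ℝ)) ω) ∂μ :=
        integral_congr_ae (ae_of_all _ ht)
    _ = μ.real B - μ.real M := by
        rw [integral_sub ((integrable_const (1 : ℝ)).indicator hB)
          ((integrable_const (1 : ℝ)).indicator hM), integral_indicator_const _ hB,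
          integral_indicator_const _ hM, smul_eq_mul, mul_one, smul_eq_mul, mul_one]

/-- **The derivative is births minus merges.** Swap the two sums, discard the pairs of `K` that are
not edges (their events are empty), and integrate the type table edge by edge. -/
theorem sum_sum_eq_sub (μ : Measure (Set ι)) [IsFiniteMeasure μ] (E : Set ι) (K F : Finset ι)
    (hF : ∀ e, e ∈ F ↔ e ∈ K ∧ e ∈ E) {N : ℕ} {A : ℕ → Set (Set ι)} {B M : ι → Set (Set ι)}
    (hA : ∀ k, MeasurableSet (A k)) (hB : ∀ e, MeasurableSet (B e))
    (hM : ∀ e, MeasurableSet (M e))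
    (ht : ∀ e ∈ F, ∀ ω : Set ι, (∑ k ∈ Finset.range N,
      ((A k).indicator (fun _ => (1 : ℝ)) (insert e ω) - (A k).indicator (fun _ => (1 : ℝ)) (ω \ {e}))) =
      (B e).indicator (fun _ => (1 : ℝ)) ω - (M e).indicator (fun _ => (1 : ℝ)) ω) :
    (∑ k ∈ Finset.range N, ∑ e ∈ K, (μ.real {ω | e ∈ E ∧ insert e ω ∈ A k} -
      μ.real {ω | e ∈ E ∧ ω \ {e} ∈ A k})) =
      (∑ e ∈ F, μ.real (B e)) - ∑ e ∈ F, μ.real (M e) := by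
  rw [Finset.sum_comm, ← Finset.sum_sub_distrib]
  have hFK : F ⊆ K := fun e he => ((hF e).1 he).1
  symm
  calc ∑ e ∈ F, (μ.real (B e) - μ.real (M e))
      = ∑ e ∈ F, ∑ k ∈ Finset.range N, (μ.real {ω | e ∈ E ∧ insert e ω ∈ A k} -
          μ.real {ω | e ∈ E ∧ ω \ {e} ∈ A k}) := by
        refine Finset.sum_congr rfl fun e he => ?_
        have heE : e ∈ E := ((hF e).1 he).2
        simp only [heE, true_and]
        exact (sum_real_insert_sub_sdiff μ e hA (hB e) (hM e) (ht e he)).symm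
    _ = ∑ e ∈ K, ∑ k ∈ Finset.range N, (μ.real {ω | e ∈ E ∧ insert e ω ∈ A k} -
          μ.real {ω | e ∈ E ∧ ω \ {e} ∈ A k}) := by
        refine Finset.sum_subset hFK fun e heK heF => ?_
        have heE : e ∉ E := fun h => heF ((hF e).2 ⟨heK, h⟩)
        simp [heE]

end Table

/-! ### Calculus glue on `ℤ^d` -/

section Zd

variable {d : ℕ}

/-- `t ↦ P_{π(t)}(C)` is continuous on `ℝ` for an event `C` determined by finitely many edges
(`π = projIcc 0 1`). -/
theorem continuous_real_of_determinedBy {C : Set (BondConfig (Site d))} {K : Finset (Sym2 (Site d))}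
    (hC : DeterminedBy C (↑K : Set (Sym2 (Site d)))) :
    Continuous fun t : ℝ =>
      (bondPercolation (zdGraph d) (Set.projIcc (0 : ℝ) 1 zero_le_one t)).real C :=
  (continuous_bondPercolation_real_of_determinedBy (zdGraph d) hC).comp continuous_projIcc

/-- **Abstract ledger.** For events `A_k`, `B_e`, `M_e` determined by the finite set `K` of pairs,
`F = K ∩ E(ℤ^d)`, the signed Russo formula for each `A_k` on `(0,1)` and the pointwise type table
for each `e ∈ F`, one has, for `0 ≤ a ≤ b ≤ 1`,
`Σ_k P_b(A_k) - Σ_k P_a(A_k) = ∫_a^b Σ_{e∈F} P_t(B_e) dt - ∫_a^b Σ_{e∈F} P_t(M_e) dt`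
(fundamental theorem of calculus; all functions of `t` are continuous). -/
theorem ledger_of (K F : Finset (Sym2 (Site d)))
    (hF : ∀ e, e ∈ F ↔ e ∈ K ∧ e ∈ (zdGraph d).edgeSet) {N : ℕ}
    {A : ℕ → Set (BondConfig (Site d))} {B M : Sym2 (Site d) → Set (BondConfig (Site d))}
    (hA : ∀ k, DeterminedBy (A k) (↑K : Set (Sym2 (Site d))))
    (hB : ∀ e, DeterminedBy (B e) (↑K : Set (Sym2 (Site d))))
    (hM : ∀ e, DeterminedBy (M e) (↑K : Set (Sym2 (Site d))))
    (hR : ∀ k, ∀ t ∈ Set.Ioo (0 : ℝ) 1, HasDerivAt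
      (fun s : ℝ => (bondPercolation (zdGraph d) (Set.projIcc (0 : ℝ) 1 zero_le_one s)).real (A k))
      (∑ e ∈ K, ((bondPercolation (zdGraph d) (Set.projIcc (0 : ℝ) 1 zero_le_one t)).real
        {ω | e ∈ (zdGraph d).edgeSet ∧ insert e ω ∈ A k} -
        (bondPercolation (zdGraph d) (Set.projIcc (0 : ℝ) 1 zero_le_one t)).real
        {ω | e ∈ (zdGraph d).edgeSet ∧ ω \ {e} ∈ A k})) t)
    (ht : ∀ e ∈ F, ∀ ω : BondConfig (Site d), (∑ k ∈ Finset.range N,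
      ((A k).indicator (fun _ => (1 : ℝ)) (insert e ω) - (A k).indicator (fun _ => (1 : ℝ)) (ω \ {e}))) =
      (B e).indicator (fun _ => (1 : ℝ)) ω - (M e).indicator (fun _ => (1 : ℝ)) ω)
    {a b : ℝ} (ha : 0 ≤ a) (hab : a ≤ b) (hb : b ≤ 1) :
    (∑ k ∈ Finset.range N, (bondPercolation (zdGraph d) (Set.projIcc (0 : ℝ) 1 zero_le_one b)).real (A k)) -
      (∑ k ∈ Finset.range N, (bondPercolation (zdGraph d) (Set.projIcc (0 : ℝ) 1 zero_le_one a)).real (A k)) =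
      (∫ t in a..b, ∑ e ∈ F, (bondPercolation (zdGraph d) (Set.projIcc (0 : ℝ) 1 zero_le_one t)).real (B e)) -
        ∫ t in a..b, ∑ e ∈ F, (bondPercolation (zdGraph d) (Set.projIcc (0 : ℝ) 1 zero_le_one t)).real (M e) := by
  have hfc : Continuous fun t : ℝ => ∑ k ∈ Finset.range N,
      (bondPercolation (zdGraph d) (Set.projIcc (0 : ℝ) 1 zero_le_one t)).real (A k) :=
    continuous_finsetSum _ fun k _ => continuous_real_of_determinedBy (hA k)
  have hBc : Continuous fun t : ℝ => ∑ e ∈ F,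
      (bondPercolation (zdGraph d) (Set.projIcc (0 : ℝ) 1 zero_le_one t)).real (B e) :=
    continuous_finsetSum _ fun e _ => continuous_real_of_determinedBy (hB e)
  have hMc : Continuous fun t : ℝ => ∑ e ∈ F,
      (bondPercolation (zdGraph d) (Set.projIcc (0 : ℝ) 1 zero_le_one t)).real (M e) :=
    continuous_finsetSum _ fun e _ => continuous_real_of_determinedBy (hM e)
  have hderiv : ∀ t ∈ Set.Ioo a b, HasDerivAt (fun s : ℝ => ∑ k ∈ Finset.range N,
      (bondPercolation (zdGraph d) (Set.projIcc (0 : ℝ) 1 zero_le_one s)).real (A k))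
      ((∑ e ∈ F, (bondPercolation (zdGraph d) (Set.projIcc (0 : ℝ) 1 zero_le_one t)).real (B e)) -
        ∑ e ∈ F, (bondPercolation (zdGraph d) (Set.projIcc (0 : ℝ) 1 zero_le_one t)).real (M e)) t := by
    intro t htab
    have ht01 : t ∈ Set.Ioo (0 : ℝ) 1 := ⟨ha.trans_lt htab.1, htab.2.trans_le hb⟩
    have hsum := HasDerivAt.fun_sum (u := Finset.range N) fun k _ => hR k t ht01
    rw [sum_sum_eq_sub _ (zdGraph d).edgeSet K F hF (fun k => (hA k).measurableSet_of_finset)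
      (fun e => (hB e).measurableSet_of_finset) (fun e => (hM e).measurableSet_of_finset) ht] at hsum
    exact hsum
  rw [← intervalIntegral.integral_sub (hBc.intervalIntegrable a b) (hMc.intervalIntegrable a b)]
  exact (intervalIntegral.integral_eq_sub_of_hasDerivAt_of_le hab hfc.continuousOn hderiv
    ((hBc.sub hMc).intervalIntegrable a b)).symm

end Zd

end StubLedger

/-- **Stub `stub_ledger`** of line `birth-merge-ledger` (crux stmt-CriticalPhenomena-4444): the
integrated birth/merge LEDGER. Granted the signed Margulis–Russo formula for cylinder events of `ℤ^d`
(first hypothesis) and the pointwise type table of an edge `e` of `B(2n)` for the representative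
counts `N_n = Σ_k 1[repEvent d k n]` (second hypothesis), for `0 ≤ a ≤ b ≤ 1`
`E_b[N_n] - E_a[N_n] = ∫_a^b Σ_{e ∈ E(B(2n))} P_t(birth_e) dt - ∫_a^b Σ_{e ∈ E(B(2n))} P_t(merge_e) dt`,
where `E_t[N_n] = Σ_{k < #B(n)} P_t(repEvent d k n)`. Instance of `StubLedger.ledger_of`. -/
theorem stub_ledger :
    (∀ (d : ℕ) (A : Set (BondConfig (Site d))) (K : Finset (Sym2 (Site d))), DeterminedBy A (↑K : Set (Sym2 (Site d))) → ∀ t ∈ Set.Ioo (0 : ℝ) 1, HasDerivAt (fun s : ℝ => (bondPercolation (zdGraph d) (Set.projIcc (0 : ℝ) 1 zero_le_one s)).real A) (∑ e ∈ K, ((bondPercolation (zdGraph d) (Set.projIcc (0 : ℝ) 1 zero_le_one t)).real {ω | e ∈ (zdGraph d).edgeSet ∧ insert e ω ∈ A} - (bondPercolation (zdGraph d) (Set.projIcc (0 : ℝ) 1 zero_le_one t)).real {ω | e ∈ (zdGraph d).edgeSet ∧ ω \ {e} ∈ A})) t) → (∀ (d n : ℕ) (e : Sym2 (Site d)) (ω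 : BondConfig (Site d)), e ∈ edgesIn (zdGraph d) (box d (2 * n)) → (∑ k ∈ Finset.range (box d n).card, ((repEvent d k n).indicator (fun _ => (1 : ℝ)) (insert e ω) - (repEvent d k n).indicator (fun _ => (1 : ℝ)) (ω \ {e}))) = {ω' : BondConfig (Site d) | ∃ x y : Site d, e = s(x, y) ∧ (∃ v ∈ box d n, ω' \ {e} ∈ openConnIn (↑(box d (2 * n)) : Set (Site d)) x v) ∧ (∀ w ∈ innerBoundary (zdGraph d) (box d (2 * n)), ω' \ {e} ∉ openConnIn (↑(box d (2 * n)) : Set (Site d)) x w) ∧ (∃ w ∈ innerBoundary (zdGraph d) (box d (2 * n)), ω' \ {e} ∈ openConnIn (↑(box d (2 * n)) : Set (Site d)) y w) ∧ (∀ v ∈ box d n, ω' \ {e} ∉ openConnIn (↑(box d (2 * n)) : Set (Site d)) y v)}.indicator (fun _ => (1 : ℝ)) ω - {ω' : BondConfig (Site d) | ∃ x y : Site d, e = s(x, y) ∧ ω' \ {e} ∉ openConnIn (↑(box d (2 * n)) : Set (Site d)) x y ∧ (∃ v ∈ box d n, ω' \ {e} ∈ openConnIn (↑(box d (2 * n))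 : Set (Site d)) x v) ∧ (∃ w ∈ innerBoundary (zdGraph d) (box d (2 * n)), ω' \ {e} ∈ openConnIn (↑(box d (2 * n)) : Set (Site d)) x w) ∧ (∃ v ∈ box d n, ω' \ {e} ∈ openConnIn (↑(box d (2 * n)) : Set (Site d)) y v) ∧ (∃ w ∈ innerBoundary (zdGraph d) (box d (2 * n)), ω' \ {e} ∈ openConnIn (↑(box d (2 * n)) : Set (Site d)) y w)}.indicator (fun _ => (1 : ℝ)) ω) → ∀ (d n : ℕ) (a b : ℝ), 0 ≤ a → a ≤ b → b ≤ 1 → (∑ k ∈ Finset.range (box d n).card, (bondPercolation (zdGraph d) (Set.projIcc (0 : ℝ) 1 zero_le_one b)).real (repEvent d k n)) - (∑ k ∈ Finset.range (box d n).card, (bondPercolation (zdGraph d) (Set.projIcc (0 : ℝ) 1 zero_le_one a)).real (repEvent d k n)) = (∫ t in a..b, ∑ e ∈ edgesIn (zdGraph d) (box d (2 * n)), (bondPercolation (zdGraph d) (Set.projIcc (0 : ℝ) 1 zero_le_one t)).real {ω : BondConfig (Site d) | ∃ x y : Site d, e = s(x, y) ∧ (∃ v ∈ box d n, ω \ {e}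 ∈ openConnIn (↑(box d (2 * n)) : Set (Site d)) x v) ∧ (∀ w ∈ innerBoundary (zdGraph d) (box d (2 * n)), ω \ {e} ∉ openConnIn (↑(box d (2 * n)) : Set (Site d)) x w) ∧ (∃ w ∈ innerBoundary (zdGraph d) (box d (2 * n)), ω \ {e} ∈ openConnIn (↑(box d (2 * n)) : Set (Site d)) y w) ∧ (∀ v ∈ box d n, ω \ {e} ∉ openConnIn (↑(box d (2 * n)) : Set (Site d)) y v)}) - ∫ t in a..b, ∑ e ∈ edgesIn (zdGraph d) (box d (2 * n)), (bondPercolation (zdGraph d) (Set.projIcc (0 : ℝ) 1 zero_le_one t)).real {ω : BondConfig (Site d) | ∃ x y : Site d, e = s(x, y) ∧ ω \ {e} ∉ openConnIn (↑(box d (2 * n)) : Set (Site d)) x y ∧ (∃ v ∈ box d n, ω \ {e} ∈ openConnIn (↑(box d (2 * n)) : Set (Site d)) x v) ∧ (∃ w ∈ innerBoundary (zdGraph d) (box d (2 * n)), ω \ {e} ∈ openConnIn (↑(box d (2 * n)) : Set (Site d)) x w) ∧ (∃ v ∈ box d n, ω \ {e} ∈ openConnIn (↑(box d (2 * n)) :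 Set (Site d)) y v) ∧ (∃ w ∈ innerBoundary (zdGraph d) (box d (2 * n)), ω \ {e} ∈ openConnIn (↑(box d (2 * n)) : Set (Site d)) y w)} := by
  intro hR hT d n a b ha hab hb
  refine StubLedger.ledger_of (box d (2 * n)).sym2 (edgesIn (zdGraph d) (box d (2 * n)))
    (fun e => by rw [mem_edgesIn_iff, Finset.mem_sym2_iff, and_comm])
    (fun k => StubLedger.determinedBy_repEvent d k n) ?_ ?_
    (fun k t ht => hR d _ _ (StubLedger.determinedBy_repEvent d k n) t ht)
    (fun e he ω => hT d n e ω he) ha hab hb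
  · intro e
    refine (determinedBy_iff _ _).2 fun ω ω' h => ?_
    have key := StubLedger.sdiff_mem_openConnIn_congr (box d (2 * n)) h e
    simp only [Set.mem_setOf_eq, key]
  · intro e
    refine (determinedBy_iff _ _).2 fun ω ω' h => ?_
    have key := StubLedger.sdiff_mem_openConnIn_congr (box d (2 * n)) h e
    simp only [Set.mem_setOf_eq, key]

end Summit.CriticalPhenomena.PercolationContinuityZ3.Theorems.NonProliferation

end
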